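import Literature.Computability.Complexity.CodeFPListKit
import Literature.Computability.Complexity.BitFormats
import Literature.Computability.Complexity.Williams2014StageAFP
import HarnessLib

/-!
# Typed polynomial time on codes: a string toolkit

Trunk T-CPLX-CORE, toolkit above `CodeFP.lean` / `CodeFPArith.lean` / `CodeFPListKit.lean` /
`CodeFPFinite.lean`: the string-level programmes a verifier parsing and emitting fixed-width
formats needs — `takeD` (truncate or pad to `k`, with `MachineA.falses_code` for the zeros), `slice` (bits `off … off+len-1`,
padded), `strFlatten` (concatenate a list of strings), `consBit`, `optStr` (an optional string as a
presence bit and a padded payload), `isZeroVal` (the binary value of a string is `0`), `getOpt`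
(`l[i]?` for unary `i`) and `dedup` (Mathlib's `List.dedup`, last occurrences, as a fold over the
reversed list). Written for the App. D machine programmes
(`Literature.Barriers.PneNP.AkaviaEtAl2006_complMemAM`), independent of them. All proved.

## References

* S. Arora, B. Barak, *Computational Complexity: A Modern Approach*, CUP 2009, §1.2–1.3.
-/

namespace Literature.Computability.Complexity

open _root_.Computability

namespace CodeFP

variable {α : Type}

/-! ### Zeros, padding, slices -/

/-- **Truncate or pad to length `k`**: `(1ᵏ, s) ↦ s.takeD k false`. [cite: AroraBarak2009, §1.3] -/
theorem takeD : CodeFP (pairE unE strE) strE (fun p => p.2.takeD p.1 false) :=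
  (strTake.comp ((fst _ _).pair (strAppend.comp ((snd _ _).pair (MachineA.falses_code.comp (fst _ _)))))).congr fun p => by
    simp only; rw [BitFormat.takeD_eq_take_append_replicate]

/-- **A padded slice**: `(1^off, 1^len, s) ↦ (s.drop off).takeD len false`. [cite: AroraBarak2009, §1.3] -/
theorem slice : CodeFP (pairE unE (pairE unE strE)) strE (fun p => (p.2.2.drop p.1).takeD p.2.1 false) :=
  takeD.comp ((snd _ _).fst'.pair (strDrop.comp ((fst _ _).pair (snd _ _).snd')))

/-! ### Concatenating strings, bits, options -/

/-- The total length of the items is at most the code length of the list. [folklore] -/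
theorem length_flatten_le_length_rawE (l : List (List Bool)) : l.flatten.length ≤ (rawE strE l).length := by
  rw [length_rawE, List.length_flatten]
  induction l with
  | nil => simp
  | cons a l ih => simp only [List.map_cons, List.sum_cons]; have : (strE a).length = a.length := rfl; omega

/-- **Concatenation of a list of strings.** [cite: AroraBarak2009, §1.3] -/
theorem strFlatten : CodeFP (rawE strE) strE List.flatten := by
  have h := foldl₀ (eα := strE) (eβ := strE) (step := fun a acc => acc ++ a) (b₀ := [])
    (strAppend.comp ((snd _ _).pair (fst _ _))) Polynomial.X (fun l₁ l₂ => by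
      rw [Polynomial.eval_X, List.foldl_append_eq_append_flatten]
      exact (length_flatten_le_length_rawE l₁).trans (by rw [rawE_append]; simp))
  exact h.congr fun l => by rw [List.foldl_append_eq_append_flatten]; rfl
where
  /-- `foldl (++)` is `flatten`. -/
  List.foldl_append_eq_append_flatten : ∀ (l : List (List Bool)) (acc : List Bool),
      l.foldl (fun acc a => acc ++ a) acc = acc ++ l.flatten
    | [], acc => by simp
    | a :: l, acc => by rw [List.foldl_cons, List.foldl_append_eq_append_flatten l, List.flatten_cons, List.append_assoc]

/-- **Prepend a bit.** [folklore] -/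
theorem consBit : CodeFP (pairE bitE strE) strE (fun p => p.1 :: p.2) :=
  (strAppend.comp (((fst _ _).recodeOut (eγ := strE) (g' := fun p => [p.1]) fun _ => rfl).pair (snd _ _))).congr fun _ => rfl

/-- **An optional string as presence bit and padded payload**: `(1ⁿ, o) ↦ o.isSome :: (o.getD []).takeD n false`. [folklore] -/
theorem optStr : CodeFP (pairE unE (optE strE)) strE (fun p => p.2.isSome :: (p.2.getD []).takeD p.1 false) := by
  have hget : CodeFP (optE strE) strE (fun o => o.getD []) :=
    ((rawHeadD strE (d := []) rfl).comp (optToList strE)).congr fun o => by cases o <;> rfl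
  exact consBit.comp (((optIsSome strE).comp (snd _ _)).pair (takeD.comp ((fst _ _).pair (hget.comp (snd _ _)))))

/-- **The binary value of a string is zero** (all bits `false`). [folklore] -/
theorem isZeroVal : CodeFP strE bitE (fun s => decide (bitsToNat s = 0)) :=
  natEq.comp (strVal.pair (const strE 0))

/-! ### Indexing and deduplication -/

/-- **`l[i]?` for unary `i`.** [cite: AroraBarak2009, §1.3] -/
theorem getOpt (eα : α → List Bool) : CodeFP (pairE unE (rawE eα)) (optE eα) (fun p => p.2[p.1]?) :=
  ((rawHead? eα).comp (rawDropUn eα)).congr fun p => by simp [List.head?_drop]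

/-- Mathlib's `dedup` as a fold over the reversed list. [folklore] -/
theorem dedup_eq_foldl_reverse [DecidableEq α] (l : List α) :
    l.dedup = l.reverse.foldl (fun acc a => if a ∈ acc then acc else a :: acc) [] := by
  rw [List.foldl_reverse]
  induction l with
  | nil => rfl
  | cons a l ih =>
    rw [List.foldr_cons, ← ih]
    by_cases h : a ∈ l.dedup
    · rw [if_pos h, List.dedup_cons_of_mem' h]
    · rw [if_neg h, List.dedup_cons_of_notMem' h]

/-- The fold's accumulator is a sub-permutation of the folded list. [folklore] -/
theorem foldl_dedupStep_subperm [DecidableEq α] (l acc : List α) (hacc : acc.Nodup) :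
    (l.foldl (fun acc a => if a ∈ acc then acc else a :: acc) acc).Subperm (acc ++ l) ∧
      (l.foldl (fun acc a => if a ∈ acc then acc else a :: acc) acc).Nodup := by
  induction l generalizing acc with
  | nil => simpa using ⟨List.Subperm.refl _, hacc⟩
  | cons a l ih =>
    rw [List.foldl_cons]
    by_cases h : a ∈ acc
    · rw [if_pos h]
      obtain ⟨h1, h2⟩ := ih acc hacc
      exact ⟨h1.trans ((List.sublist_cons_self a l).append_left acc).subperm, h2⟩
    · rw [if_neg h]
      obtain ⟨h1, h2⟩ := ih (a :: acc) (List.nodup_cons.2 ⟨h, hacc⟩)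
      refine ⟨h1.trans ?_, h2⟩
      exact (List.perm_middle.symm.subperm)

/-- **Deduplication** (`List.dedup`, keeping last occurrences). [cite: AroraBarak2009, §1.3] -/
theorem dedup [DecidableEq α] (eα : α → List Bool) (he : Function.Injective eα) : CodeFP (rawE eα) (rawE eα) List.dedup := by
  have hstep : CodeFP (pairE eα (rawE eα)) (rawE eα) (fun t => if t.1 ∈ t.2 then t.2 else t.1 :: t.2) :=
    (ite (mem he) (snd _ _) (rawCons eα)).congr fun t => by
      by_cases hm : t.1 ∈ t.2 <;> simp [hm]
  have h := foldl₀ (eα := eα) (eβ := rawE eα) (step := fun a acc => if a ∈ acc then acc else a :: acc) (b₀ := [])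
    hstep Polynomial.X (fun l₁ l₂ => by
      rw [Polynomial.eval_X]
      have hs := (foldl_dedupStep_subperm l₁ [] List.nodup_nil).1
      simp only [List.nil_append] at hs
      exact (length_rawE_le_of_subperm eα hs).trans (length_rawE_le_of_sublist eα (List.sublist_append_left l₁ l₂)))
  exact (h.comp (rawReverse eα)).congr fun l => (dedup_eq_foldl_reverse l).symm

end CodeFP

end Literature.Computability.Complexity
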